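import Literature.AlgebraicGeometry.Motives.PoincareUniversal.ResidualStatement
import Literature.AlgebraicGeometry.AbelianVarieties.RigidifiedLineBundleLimitDescent
import Literature.AlgebraicGeometry.AbelianSchemes.RigidifiedGluing
import Literature.AlgebraicGeometry.AbelianVarieties.UnitPointSlices
import HarnessLib

/-!
# The universal property of the normalised Poincaré sheaf: from affine finite-type bases to all bases

Topic: `Literature/AlgebraicGeometry/Motives/PoincareUniversal`. The residual `U_a3_residual_poincareUniversal` of
★ `Motives/PoincareUniversal/ResidualStatement` (universal property of the normalised Poincaré sheaf of `(A₀, Θ)` over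
EVERY `ℂ`-scheme) follows from its affine-finite-type form `U_a3_residual_affineFiniteType`
(`stub_M13_0_of_affineFiniteType_holds`): `∃!` is Zariski-local on the test scheme modulo rigidified gluing
(★ `AbelianSchemes/PoincareUniversalLocality`, ★ `AbelianSchemes/RigidifiedGluing`), and over an affine test scheme it
descends to a finitely generated subalgebra (★ `AbelianVarieties/RigidifiedLineBundleLimitDescent`) — Mumford's
reduction in the proof of [MumfordAV1970] §13. Plus the one adapter `sliceZero_left_eq_unitSlice` (Mumford's zero slice
IS `ε × 1` on underlying schemes). Everything is proved; theorems only; no named facts.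

## References
* [MumfordAV1970] D. Mumford, *Abelian Varieties* (1970), §13 (Thm. p. 125 and its proof), §8 (pp. 78–80).
* [MumfordFogartyKirwan1994] D. Mumford, J. Fogarty, F. Kirwan, *Geometric Invariant Theory*, 3rd ed. (1994), Ch. 6 §2 (p. 121).
* [StacksProject] The Stacks Project, Tags 01ZC, 0B8W.
-/

universe u

open CategoryTheory CategoryTheory.Limits AlgebraicGeometry MonoidalCategory CartesianMonoidalCategory

namespace Literature.AlgebraicGeometry.Motives.AbelianVariety

open Literature.AlgebraicGeometry.AbelianSchemes Literature.AlgebraicGeometry.AbelianVarieties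
  Literature.AlgebraicGeometry.Modules

set_option backward.isDefEq.respectTransparency false

/-! ### §1 The adapter: Mumford's `ι = (0, id)` IS `ε × 1` on underlying schemes -/

/-- **`sliceZero = unitSlice` on underlying schemes**: the zero slice `(0, id) : B₀ → A₀ × B₀` of two abelian
varieties (★ `AbelianVarieties.sliceZero`, cartesian-monoidal currency) has underlying morphism the slice
`ε × 1_{B₀}` of the abelian schemes `A₀ × Spec K`, `B₀ × Spec K` over `Spec K` (★ `AbelianSchemeOver.unitSlice`,
D2 currency) — both projections agree (★ `lift_one_id_left_comp_pullback_fst/snd`, ★ `unitSlice_fst/snd`).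
[cite: MumfordFogartyKirwan1994, Ch. 6 §2 (p. 121)] [cite: MumfordAV1970, §8 (pp. 78–80)] -/
theorem sliceZero_left_eq_unitSlice {K : Type u} [Field K] (A₀ B₀ : AbelianVariety K) :
    (sliceZero A₀ B₀).left =
      (AbelianSchemeOver.ofAbelianVariety A₀).unitSlice (AbelianSchemeOver.ofAbelianVariety B₀) := by
  apply pullback.hom_ext
  · exact (lift_one_id_left_comp_pullback_fst A₀ B₀.X).trans
      ((AbelianSchemeOver.ofAbelianVariety A₀).unitSlice_fst (AbelianSchemeOver.ofAbelianVariety B₀)).symm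
  · exact (lift_one_id_left_comp_pullback_snd A₀ B₀.X).trans
      ((AbelianSchemeOver.ofAbelianVariety A₀).unitSlice_snd (AbelianSchemeOver.ofAbelianVariety B₀)).symm

/-! ### §2 From affine finite type to all bases -/

/-- **M13 N0 — `stub_M13_0_of_affineFiniteType` PROVED**: the universal property of the normalised Poincaré sheaf
over ALL `ℂ`-schemes `T` follows from the universal property over the AFFINE `ℂ`-schemes OF FINITE TYPE:
(0c) `∃!` is Zariski-local on `T` (B-p02, `existsUnique_classify_of_affine`) modulo (0b) rigidified gluing, which holds
for `A₀ × T → T` (B-p02, `rigidifiedGluing_ofAbelianVariety`), and (0d) over an affine `T = Spec R` the datum descends to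
a stage `Spec ℂ[t]` of the Noetherian approximation `Spec R = lim Spec ℂ[t]` where the finite-type statement applies, with
uniqueness by Stacks 01ZC + descent of isomorphisms (B-p14, `existsUnique_classify_affine_of_finiteType_ofAbelianVariety`).
[cite: MumfordAV1970, §13 (Thm. p. 125 and its proof)] [cite: StacksProject, Tag 01ZC and Tag 0B8W] -/
theorem stub_M13_0_of_affineFiniteType_holds :
    U_a3_residual_affineFiniteType → U_a3_residual_poincareUniversal := by
  intro haff A₀ Θ hΘ P _ hP1 eP hnorm T f ℒ hℒ
  -- the carriers: `(A₀.X ⊗ Â.X).left` IS `(A₀ × Spec ℂ) ×_{Spec ℂ} (Â × Spec ℂ)` (definitionally)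
  let A : AbelianSchemeOver (Spec (.of ℂ)) := AbelianSchemeOver.ofAbelianVariety A₀
  let B : AbelianSchemeOver (Spec (.of ℂ)) := AbelianSchemeOver.ofAbelianVariety (A₀.dualOf Θ hΘ)
  let P' : (A.prodLeft B).Modules := P
  have hP1' : HasRank P' 1 := hP1
  have hnorm' : Nonempty ((Scheme.Modules.pullback (A.unitSlice B)).obj P' ≅ SheafOfModules.unit _) :=
    hnorm.map fun e => (Scheme.Modules.pullbackCongr (sliceZero_left_eq_unitSlice A₀ (A₀.dualOf Θ hΘ)).symm).app P ≪≫ e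
  have haff' : ∀ (T' : Scheme.{0}) [IsAffine T'] (f' : T' ⟶ Spec (.of ℂ)) [LocallyOfFiniteType f']
      (ℒ' : A.RigidifiedLineBundle f'), ℒ'.FibrewisePicZero →
      ∃! g : {g : T' ⟶ B.X.left // g ≫ B.X.hom = f'},
        Nonempty ((Scheme.Modules.pullback (A.baseChangeToProd B f' g.1 g.2)).obj P' ≅ ℒ'.L) :=
    fun T' _ f' _ ℒ' hℒ' => haff A₀ Θ hΘ P hP1 eP hnorm f' ℒ' hℒ'
  exact A.existsUnique_classify_of_affine B P' (AbelianSchemeOver.rigidifiedGluing_ofAbelianVariety A₀ B P' hP1')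
    hnorm' (AbelianSchemeOver.existsUnique_classify_affine_of_finiteType_ofAbelianVariety A₀ B P' hP1' haff') f ℒ hℒ

end Literature.AlgebraicGeometry.Motives.AbelianVariety
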